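import Summits.CriticalPhenomena.Ising3DConformalLimit.Theorems.GaussianScaleMixtureLimitKernelGSMDamped
import HarnessLib

/-!
# Pointwise limits of Laplace transforms of finite orthant measures are Laplace transforms

Helper file 2/2 for item stmt-CriticalPhenomena-8368 (`LimitKernelGSM`, route GaussianScaleMixture,
sub-problem Ising3DConformalLimit).

Main result `exists_measure_laplace_eq_of_tendsto`: let `μ a` (`a` along a filter `l ≠ ⊥`) be
finite measures on `ℝ^ι` (`ι` finite) carried by the closed orthant, with
`∫ exp(-∑ sᵢvᵢ) dμ_a → Φ(v)` for every `v ≥ 0`, `v ≠ 0`, and suppose `Φ(v + η𝟙) → Φ(v)` as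
`η → 0⁺` at every such `v` (inner continuity at the faces). Then there is ONE measure `ν` carried by
the orthant (Radon, possibly infinite) with `exp(-∑ sᵢvᵢ)` `ν`-integrable and
`Φ(v) = ∫ exp(-∑ sᵢvᵢ) dν` for all `v ≥ 0`, `v ≠ 0`.

Proof: the weak limits `κ_ε` of the damped families (file 1) have Laplace transforms
`Φ(· + ε𝟙)` (`integral_limit_damp`); limits for `ε ≤ ε'` are consistent,
`κ_{ε'} = exp(-(ε'-ε)∑max(sᵢ,0)) κ_ε`, by uniqueness of weak limits of finite measures
(`limit_damp_consistent`); `ν := exp(+∑max(sᵢ,0)) κ₁` then represents `Φ` on the open orthant, and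
on the faces by monotone convergence plus inner continuity. No Bernstein–Widder theorem is needed.
Also here: antitonicity of Laplace integrals of orthant measures in the dual variable
(`integral_exp_anti`).

References: Berg–Christensen–Ressel (1984) §4.6 (context); Billingsley, *Convergence of
Probability Measures*, §5 (Prokhorov), as formalised in `Mathlib.MeasureTheory.Measure.Prokhorov`.
-/

noncomputable section

namespace Summit.CriticalPhenomena.Ising3DConformalLimit.Theorems.LimitKernelGSM

open MeasureTheory Filter Topology Set
open scoped ENNReal NNReal BoundedContinuousFunction

variable {ι : Type*} [Fintype ι]

/-! ## Laplace transforms of the weak limits and their consistency -/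

section Limit

variable {α : Type*} {l : Filter α} (μ : α → Measure (ι → ℝ)) [∀ a, IsFiniteMeasure (μ a)]
  (Φ : (ι → ℝ) → ℝ)

/-- **Laplace transform of the weak limit**: `∫ exp(-∑ sᵢuᵢ) dκ = Φ(u + ε𝟙)` for `u ≥ 0`. [folklore] -/
theorem integral_limit_damp [NeBot l] (hsupp : ∀ a, μ a {s | ∃ i, s i < 0} = 0)
    (hlim : ∀ v : ι → ℝ, (∀ i, 0 ≤ v i) → v ≠ 0 →
      Tendsto (fun a => ∫ s, Real.exp (-∑ i, s i * v i) ∂(μ a)) l (𝓝 (Φ v)))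
    [Nonempty ι] {ε : ℝ} (hε : 0 < ε) (κ : FiniteMeasure (ι → ℝ))
    (hκ : Tendsto (β := FiniteMeasure (ι → ℝ)) (fun a => ⟨(μ a).withDensity fun s =>
          ENNReal.ofReal (Real.exp (-∑ i, max (s i) 0 * ε)), isFiniteMeasure_damp (μ a) hε.le⟩)
        (Ultrafilter.of l : Filter α) (𝓝 κ))
    (hκ0 : (κ : Measure (ι → ℝ)) {s | ∃ i, s i < 0} = 0) {u : ι → ℝ} (hu : ∀ i, 0 ≤ u i) :
    ∫ s, Real.exp (-∑ i, s i * u i) ∂(κ : Measure (ι → ℝ)) = Φ (fun i => u i + ε) := by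
  obtain ⟨f, hf⟩ := exists_bcf_kerB hu
  have hT := (FiniteMeasure.tendsto_iff_forall_integral_tendsto.1 hκ) f
  -- the integrals along the family
  have hTa : ∀ a, ∫ s, f s ∂(FiniteMeasure.toMeasure ⟨(μ a).withDensity fun s =>
      ENNReal.ofReal (Real.exp (-∑ i, max (s i) 0 * ε)), isFiniteMeasure_damp (μ a) hε.le⟩) =
      ∫ s, Real.exp (-∑ i, s i * (u i + ε)) ∂(μ a) := by
    intro a
    change ∫ s, f s ∂((μ a).withDensity fun s =>
      ENNReal.ofReal (Real.exp (-∑ i, max (s i) 0 * ε))) = _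
    rw [integral_damp, ← integral_kerB_eq (hsupp a)]
    refine integral_congr_ae (Eventually.of_forall fun s => ?_)
    simp only [hf]
    rw [mul_comm, ← kerB_add]
  simp_rw [hTa] at hT
  have hne : (fun i => u i + ε) ≠ 0 := fun h => by
    have h0 : u (Classical.arbitrary ι) + ε = 0 := by
      simpa using congr_fun h (Classical.arbitrary ι)
    linarith [hu (Classical.arbitrary ι)]
  have hl := (hlim (fun i => u i + ε) (fun i => by linarith [hu i]) hne).mono_left
    (Ultrafilter.of_le l)
  have heq := tendsto_nhds_unique hT hl
  rw [← heq, ← integral_kerB_eq hκ0]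
  exact integral_congr_ae (Eventually.of_forall fun s => (hf s).symm)

/-- **Consistency of the weak limits** for two damping parameters `ε ≤ ε'`:
`κ' = exp(-(ε'-ε)∑max(sᵢ,0)) · κ` (uniqueness of weak limits of finite measures). [folklore] -/
theorem limit_damp_consistent [NeBot l] {ε ε' : ℝ} (hε : 0 < ε) (hε' : 0 < ε') (hle : ε ≤ ε')
    (κ κ' : FiniteMeasure (ι → ℝ))
    (hκ : Tendsto (β := FiniteMeasure (ι → ℝ)) (fun a => ⟨(μ a).withDensity fun s =>
          ENNReal.ofReal (Real.exp (-∑ i, max (s i) 0 * ε)), isFiniteMeasure_damp (μ a) hε.le⟩)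
        (Ultrafilter.of l : Filter α) (𝓝 κ))
    (hκ' : Tendsto (β := FiniteMeasure (ι → ℝ)) (fun a => ⟨(μ a).withDensity fun s =>
          ENNReal.ofReal (Real.exp (-∑ i, max (s i) 0 * ε')), isFiniteMeasure_damp (μ a) hε'.le⟩)
        (Ultrafilter.of l : Filter α) (𝓝 κ')) :
    (κ' : Measure (ι → ℝ)) = (κ : Measure (ι → ℝ)).withDensity fun s =>
      ENNReal.ofReal (Real.exp (-∑ i, max (s i) 0 * (ε' - ε))) := by
  have hd : 0 ≤ ε' - ε := sub_nonneg.2 hle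
  -- the damping operator on finite measures
  let D : FiniteMeasure (ι → ℝ) → FiniteMeasure (ι → ℝ) := fun θ =>
    ⟨(θ : Measure (ι → ℝ)).withDensity fun s =>
      ENNReal.ofReal (Real.exp (-∑ i, max (s i) 0 * (ε' - ε))), isFiniteMeasure_damp _ hd⟩
  obtain ⟨f, hf⟩ := exists_bcf_kerB (u := fun _ : ι => ε' - ε) (fun _ => hd)
  -- `D` is sequentially (filter-) continuous
  have hD : Tendsto (fun a => D ⟨(μ a).withDensity fun s =>
      ENNReal.ofReal (Real.exp (-∑ i, max (s i) 0 * ε)), isFiniteMeasure_damp (μ a) hε.le⟩)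
      (Ultrafilter.of l : Filter α) (𝓝 (D κ)) := by
    refine FiniteMeasure.tendsto_iff_forall_integral_tendsto.2 fun g => ?_
    have key : ∀ θ : FiniteMeasure (ι → ℝ),
        ∫ s, g s ∂(D θ : Measure (ι → ℝ)) = ∫ s, (f * g) s ∂(θ : Measure (ι → ℝ)) := by
      intro θ
      change ∫ s, g s ∂((θ : Measure (ι → ℝ)).withDensity fun s =>
        ENNReal.ofReal (Real.exp (-∑ i, max (s i) 0 * (ε' - ε)))) = _
      rw [integral_damp]
      refine integral_congr_ae (Eventually.of_forall fun s => ?_)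
      simp only [BoundedContinuousFunction.coe_mul, Pi.mul_apply, hf]
    simp_rw [key]
    exact (FiniteMeasure.tendsto_iff_forall_integral_tendsto.1 hκ) (f * g)
  -- and it maps the `ε`-damped family to the `ε'`-damped family
  have hDF : ∀ a, D ⟨(μ a).withDensity fun s =>
      ENNReal.ofReal (Real.exp (-∑ i, max (s i) 0 * ε)), isFiniteMeasure_damp (μ a) hε.le⟩ =
      ⟨(μ a).withDensity fun s => ENNReal.ofReal (Real.exp (-∑ i, max (s i) 0 * ε')),
        isFiniteMeasure_damp (μ a) hε'.le⟩ := by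
    intro a
    apply Subtype.ext
    change ((μ a).withDensity fun s => ENNReal.ofReal (Real.exp (-∑ i, max (s i) 0 * ε))).withDensity
        (fun s => ENNReal.ofReal (Real.exp (-∑ i, max (s i) 0 * (ε' - ε)))) =
      (μ a).withDensity fun s => ENNReal.ofReal (Real.exp (-∑ i, max (s i) 0 * ε'))
    rw [← withDensity_mul _ (continuous_kerB (fun _ => ε)).measurable.ennreal_ofReal
      (continuous_kerB (fun _ => ε' - ε)).measurable.ennreal_ofReal]
    congr 1
    funext s
    simp only [Pi.mul_apply]
    rw [← ENNReal.ofReal_mul (Real.exp_pos _).le, ← kerB_add]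
    congr 3
    exact Finset.sum_congr rfl fun i _ => by ring
  simp_rw [hDF] at hD
  have := tendsto_nhds_unique hκ' hD
  rw [this]
  rfl

end Limit

/-! ## Laplace integrals of orthant measures are antitone in the dual variable -/

/-- `a ≤ b` (coordinatewise, `a ≥ 0`) gives `∫ exp(-∑ sᵢbᵢ) dν ≤ ∫ exp(-∑ sᵢaᵢ) dν` for a finite
measure `ν` on the orthant. [folklore] -/
theorem integral_exp_anti {ν : Measure (ι → ℝ)} [IsFiniteMeasure ν]
    (hν0 : ν {s | ∃ i, s i < 0} = 0) {a b : ι → ℝ} (ha : ∀ i, 0 ≤ a i) (hab : ∀ i, a i ≤ b i) :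
    ∫ s, Real.exp (-∑ i, s i * b i) ∂ν ≤ ∫ s, Real.exp (-∑ i, s i * a i) ∂ν := by
  have hae := ae_nonneg_of_compl_null hν0
  have hint : ∀ c : ι → ℝ, (∀ i, 0 ≤ c i) →
      Integrable (fun s => Real.exp (-∑ i, s i * c i)) ν := by
    intro c hc
    refine Integrable.mono' (integrable_const (1 : ℝ))
      (Continuous.aestronglyMeasurable (by fun_prop)) (hae.mono fun s hs => ?_)
    rw [Real.norm_eq_abs, abs_of_pos (Real.exp_pos _), Real.exp_le_one_iff, neg_nonpos]
    exact Finset.sum_nonneg fun i _ => mul_nonneg (hs i) (hc i)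
  refine integral_mono_ae (hint b fun i => (ha i).trans (hab i)) (hint a ha)
    (hae.mono fun s hs => ?_)
  exact Real.exp_le_exp.2 (neg_le_neg (Finset.sum_le_sum fun i _ =>
    mul_le_mul_of_nonneg_left (hab i) (hs i)))

/-! ## The representation theorem -/

/-- **Pointwise limits of Laplace transforms of finite orthant measures are Laplace transforms.**
If finite measures `μ a` on the closed orthant of `ℝ^ι` have Laplace transforms converging pointwise
on the orthant minus the origin to `Φ`, and `Φ(v + η𝟙) → Φ(v)` as `η → 0⁺` at every such `v`, then
`Φ(v) = ∫ exp(-∑ sᵢvᵢ) dν` for one measure `ν` carried by the orthant, the integrand being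
integrable, at every `v ≥ 0`, `v ≠ 0`. [folklore] -/
theorem exists_measure_laplace_eq_of_tendsto {α : Type*} {l : Filter α} [NeBot l]
    (μ : α → Measure (ι → ℝ)) [∀ a, IsFiniteMeasure (μ a)]
    (hsupp : ∀ a, μ a {s | ∃ i, s i < 0} = 0) (Φ : (ι → ℝ) → ℝ)
    (hlim : ∀ v : ι → ℝ, (∀ i, 0 ≤ v i) → v ≠ 0 →
      Tendsto (fun a => ∫ s, Real.exp (-∑ i, s i * v i) ∂(μ a)) l (𝓝 (Φ v)))
    (hcont : ∀ v : ι → ℝ, (∀ i, 0 ≤ v i) → v ≠ 0 →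
      Tendsto (fun η : ℝ => Φ (fun i => v i + η)) (𝓝[>] 0) (𝓝 (Φ v))) :
    ∃ ν : Measure (ι → ℝ), ν {s | ∃ i, s i < 0} = 0 ∧ ∀ v : ι → ℝ, (∀ i, 0 ≤ v i) → v ≠ 0 →
      Integrable (fun s => Real.exp (-∑ i, s i * v i)) ν ∧
        Φ v = ∫ s, Real.exp (-∑ i, s i * v i) ∂ν := by
  rcases isEmpty_or_nonempty ι with hι | hι
  · exact ⟨0, by simp, fun v _ hv => absurd (Subsingleton.elim v 0) hv⟩
  -- nonnegativity of `Φ`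
  have hΦ : ∀ v : ι → ℝ, (∀ i, 0 ≤ v i) → v ≠ 0 → 0 ≤ Φ v := fun v hv hv0 =>
    ge_of_tendsto' (hlim v hv hv0) fun a => integral_nonneg fun s => (Real.exp_pos _).le
  -- the weak limits of the damped families, one for each `ε > 0`
  have hex : ∀ ε : {ε : ℝ // 0 < ε}, ∃ κ : FiniteMeasure (ι → ℝ),
      Tendsto (β := FiniteMeasure (ι → ℝ)) (fun a => ⟨(μ a).withDensity fun s =>
          ENNReal.ofReal (Real.exp (-∑ i, max (s i) 0 * (ε : ℝ))),
            isFiniteMeasure_damp (μ a) ε.2.le⟩)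
        (Ultrafilter.of l : Filter α) (𝓝 κ) ∧
      (κ : Measure (ι → ℝ)) {s | ∃ i, s i < 0} = 0 :=
    fun ε => exists_limit_damp μ Φ hsupp hlim ε.2
  choose κ hκ hκ0 using hex
  -- undo the damping at `ε = 1`
  let ν : Measure (ι → ℝ) := (κ ⟨1, one_pos⟩ : Measure (ι → ℝ)).withDensity fun s =>
    ENNReal.ofReal (Real.exp (∑ i, max (s i) 0))
  have hν0 : ν {s | ∃ i, s i < 0} = 0 := withDensity_absolutelyContinuous _ _ (hκ0 _)
  -- Step 1: the representation on the open orthant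
  have hopen : ∀ v : ι → ℝ, (∀ i, 0 < v i) →
      Integrable (fun s => Real.exp (-∑ i, s i * v i)) ν ∧
        Φ v = ∫ s, Real.exp (-∑ i, s i * v i) ∂ν := by
    intro v hv
    -- a damping parameter below `min vᵢ` and below `1`
    obtain ⟨ε, hε, hε1, hεv⟩ : ∃ ε : ℝ, 0 < ε ∧ ε ≤ 1 ∧ ∀ i, ε ≤ v i := by
      obtain ⟨i₀, -, hi₀⟩ := Finset.exists_min_image Finset.univ v Finset.univ_nonempty
      exact ⟨min (v i₀) 1, lt_min (hv i₀) one_pos, min_le_right _ _,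
        fun i => (min_le_left _ _).trans (hi₀ i (Finset.mem_univ i))⟩
    have hcons := limit_damp_consistent μ hε one_pos hε1 (κ ⟨ε, hε⟩) (κ ⟨1, one_pos⟩)
      (hκ ⟨ε, hε⟩) (hκ ⟨1, one_pos⟩)
    -- the integrand against `κ ε` is the bounded kernel at `v - ε𝟙`
    have hvε : ∀ i, 0 ≤ v i - ε := fun i => sub_nonneg.2 (hεv i)
    have hId : ∀ s : ι → ℝ, (∀ i, 0 ≤ s i) →
        Real.exp (-∑ i, max (s i) 0 * (1 - ε)) * (Real.exp (∑ i, max (s i) 0) *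
          Real.exp (-∑ i, s i * v i)) = Real.exp (-∑ i, max (s i) 0 * (v i - ε)) := by
      intro s hs
      rw [← Real.exp_add, ← Real.exp_add]
      congr 1
      have : ∀ i, max (s i) 0 = s i := fun i => max_eq_left (hs i)
      simp only [this, ← Finset.sum_neg_distrib, ← Finset.sum_add_distrib]
      exact Finset.sum_congr rfl fun i _ => by ring
    have hcu : Continuous fun s : ι → ℝ => Real.exp (∑ i, max (s i) 0) := by fun_prop
    have hae : ∀ᵐ s ∂(κ ⟨ε, hε⟩ : Measure (ι → ℝ)), ∀ i, 0 ≤ s i := ae_nonneg_of_compl_null (hκ0 _)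
    -- integrability
    have hint : Integrable (fun s => Real.exp (-∑ i, s i * v i)) ν := by
      change Integrable _ (((κ ⟨1, one_pos⟩ : Measure (ι → ℝ))).withDensity fun s =>
        ENNReal.ofReal (Real.exp (∑ i, max (s i) 0)))
      rw [hcons, integrable_withDensity_ofReal_continuous _ hcu (fun s => (Real.exp_pos _).le),
        integrable_withDensity_ofReal_continuous _ (continuous_kerB _)
          (fun s => (Real.exp_pos _).le)]
      refine (integrable_kerB _ hvε).congr (hae.mono fun s hs => ?_)
      exact (hId s hs).symm
    refine ⟨hint, ?_⟩
    -- the value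
    change Φ v = ∫ s, Real.exp (-∑ i, s i * v i) ∂(((κ ⟨1, one_pos⟩ : Measure (ι → ℝ))).withDensity
      fun s => ENNReal.ofReal (Real.exp (∑ i, max (s i) 0)))
    rw [hcons, integral_withDensity_ofReal_continuous _ hcu (fun s => (Real.exp_pos _).le),
      integral_damp]
    have h1 : ∫ s, Real.exp (-∑ i, max (s i) 0 * (1 - ε)) *
        (Real.exp (∑ i, max (s i) 0) * Real.exp (-∑ i, s i * v i)) ∂(κ ⟨ε, hε⟩ : Measure (ι → ℝ)) =
        ∫ s, Real.exp (-∑ i, s i * (v i - ε)) ∂(κ ⟨ε, hε⟩ : Measure (ι → ℝ)) := by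
      rw [← integral_kerB_eq (hκ0 _)]
      exact integral_congr_ae (hae.mono fun s hs => hId s hs)
    rw [h1, integral_limit_damp μ Φ hsupp hlim hε (κ ⟨ε, hε⟩) (hκ ⟨ε, hε⟩) (hκ0 _) hvε]
    congr 1
    funext i
    ring
  -- Step 2: the faces, by monotone convergence and inner continuity of `Φ`
  refine ⟨ν, hν0, fun v hv hv0 => ?_⟩
  have hνae : ∀ᵐ s ∂ν, ∀ i, 0 ≤ s i := ae_nonneg_of_compl_null hν0
  have hηpos : ∀ n : ℕ, (0 : ℝ) < 1 / ((n : ℝ) + 1) := fun n => by positivity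
  have hηanti : ∀ {m n : ℕ}, m ≤ n → (1 : ℝ) / ((n : ℝ) + 1) ≤ 1 / ((m : ℝ) + 1) := fun hmn =>
    one_div_le_one_div_of_le (by positivity) (by exact_mod_cast Nat.add_le_add_right hmn 1)
  have hηlim : Tendsto (fun n : ℕ => (1 : ℝ) / ((n : ℝ) + 1)) atTop (𝓝[>] 0) :=
    tendsto_nhdsWithin_iff.2 ⟨tendsto_one_div_add_atTop_nhds_zero_nat,
      Eventually.of_forall fun n => hηpos n⟩
  have hstep : ∀ n : ℕ,
      Integrable (fun s => Real.exp (-∑ i, s i * (v i + 1 / ((n : ℝ) + 1)))) ν ∧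
      Φ (fun i => v i + 1 / ((n : ℝ) + 1)) =
        ∫ s, Real.exp (-∑ i, s i * (v i + 1 / ((n : ℝ) + 1))) ∂ν :=
    fun n => hopen (fun i => v i + 1 / ((n : ℝ) + 1)) fun i => by linarith [hv i, hηpos n]
  -- monotone convergence in `lintegral` form
  have hmono : ∀ᵐ s ∂ν, Monotone fun n : ℕ =>
      ENNReal.ofReal (Real.exp (-∑ i, s i * (v i + 1 / ((n : ℝ) + 1)))) := by
    refine hνae.mono fun s hs m n hmn => ENNReal.ofReal_le_ofReal (Real.exp_le_exp.2 ?_)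
    simp only [neg_le_neg_iff]
    exact Finset.sum_le_sum fun i _ =>
      mul_le_mul_of_nonneg_left (by linarith [hηanti hmn]) (hs i)
  have hptw : ∀ s : ι → ℝ, Tendsto (fun n : ℕ =>
      ENNReal.ofReal (Real.exp (-∑ i, s i * (v i + 1 / ((n : ℝ) + 1)))))
      atTop (𝓝 (ENNReal.ofReal (Real.exp (-∑ i, s i * v i)))) := by
    intro s
    refine ENNReal.tendsto_ofReal ((Real.continuous_exp.tendsto _).comp ?_)
    refine Tendsto.neg (tendsto_finsetSum _ fun i _ => ?_)
    have h : Tendsto (fun n : ℕ => v i + 1 / ((n : ℝ) + 1)) atTop (𝓝 (v i + 0)) :=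
      tendsto_const_nhds.add tendsto_one_div_add_atTop_nhds_zero_nat
    rw [add_zero] at h
    exact tendsto_const_nhds.mul h
  have hsup : ∀ᵐ s ∂ν, (⨆ n : ℕ, ENNReal.ofReal (Real.exp (-∑ i, s i * (v i + 1 / ((n : ℝ) + 1))))) =
      ENNReal.ofReal (Real.exp (-∑ i, s i * v i)) :=
    hmono.mono fun s hs => tendsto_nhds_unique (tendsto_atTop_iSup hs) (hptw s)
  have hlin : ∫⁻ s, ENNReal.ofReal (Real.exp (-∑ i, s i * v i)) ∂ν = ENNReal.ofReal (Φ v) := by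
    rw [← lintegral_congr_ae hsup, lintegral_iSup' (fun n => ?_) hmono]
    · have hΦn : ∀ n : ℕ,
          ∫⁻ s, ENNReal.ofReal (Real.exp (-∑ i, s i * (v i + 1 / ((n : ℝ) + 1)))) ∂ν =
            ENNReal.ofReal (Φ (fun i => v i + 1 / ((n : ℝ) + 1))) := fun n => by
        rw [(hstep n).2, ofReal_integral_eq_lintegral_ofReal (hstep n).1
          (Eventually.of_forall fun s => (Real.exp_pos _).le)]
      simp_rw [hΦn]
      have hmono' : Monotone fun n : ℕ => ENNReal.ofReal (Φ (fun i => v i + 1 / ((n : ℝ) + 1))) := by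
        intro m n hmn
        dsimp only
        rw [← hΦn, ← hΦn]
        exact lintegral_mono_ae (hmono.mono fun s hs => hs hmn)
      exact tendsto_nhds_unique (tendsto_atTop_iSup hmono')
        (ENNReal.tendsto_ofReal ((hcont v hv hv0).comp hηlim))
    · exact (Measurable.ennreal_ofReal (by fun_prop)).aemeasurable
  have hmeasv : AEStronglyMeasurable (fun s : ι → ℝ => Real.exp (-∑ i, s i * v i)) ν :=
    (Continuous.aestronglyMeasurable (by fun_prop))
  have hint : Integrable (fun s => Real.exp (-∑ i, s i * v i)) ν := by
    refine ⟨hmeasv, ?_⟩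
    rw [hasFiniteIntegral_iff_ofReal (Eventually.of_forall fun s => (Real.exp_pos _).le), hlin]
    exact ENNReal.ofReal_lt_top
  refine ⟨hint, ?_⟩
  rw [integral_eq_lintegral_of_nonneg_ae (Eventually.of_forall fun s => (Real.exp_pos _).le) hmeasv,
    hlin, ENNReal.toReal_ofReal (hΦ v hv hv0)]


end Summit.CriticalPhenomena.Ising3DConformalLimit.Theorems.LimitKernelGSM

end
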